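import Literature.Geometry.Manifold.DeRhamOrientationSignFour
import Literature.Geometry.Symplectic.AlmostComplexTopChernNumberFourReductions
import HarnessLib

/-!
# `⟨c₂(TN, J), [N]_μ⟩ = ε u χ(N)`: the top Chern number on the complex orientation, up to one universal bit

D. McDuff, D. Salamon, *Introduction to Symplectic Topology*, 3rd ed. (2017), Ex. 4.4.3 (v),
Rem. 4.1.10, Rem. 4.1.12, §13.3 p. 527; F. Hirzebruch, *Topological Methods in Algebraic Geometry*
(1966), Thm. 4.10.1; G. E. Bredon, *Topology and Geometry* (1993), VI.7 and Thm. V.9.5.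

The tree proves `⟨c₂(TN, J), [N]_{μ_o}⟩ = u · χ(N)` for the ATLAS orientation `μ_o` of a `J`-positive
form (`kroneckerPairing_chernClass_two_homologicalOrientationOfSmooth`, `u = topChernSignFour = ±1`)
and that the sign of the de Rham/fundamental-class pairing on `μ_o` is a universal `ε = deRhamSignFour`
(`deRhamSignFour_mul_rayPeriod_pos`).  Since the COMPLEX orientation `μ_J` is the one on which
`J`-positive forms pair positively, `[N]_{μ_J} = ε [N]_{μ_o}`
(`IsComplexOrientationOf.eq_or_eq_neg_of_deRhamSignFour`), whence

* **`kroneckerPairing_chernClass_two_of_isComplexOrientationOf`** —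
  `⟨c₂(TN, J), [N]_μ⟩ = ε u · χ(N)` for EVERY closed connected almost complex `4`-manifold and every
  homological orientation `μ` induced by `J`, with ONE universal bit `ε u = chernSignBit ∈ {±1}`;
* `chernSignBit_eq_one_of_example` — the bit is `+1` as soon as ONE closed connected almost complex
  `4`-manifold with `χ ≠ 0` has `⟨c₂, [N]_μ⟩ = χ(N)` (McDuff–Salamon Ex. 4.4.3 (v));
* `kroneckerPairing_chernClass_two_eq_relEuler_of_chernSignBit` — conversely the bit gives
  `⟨c₂(TN, J), [N]_μ⟩ = χ(N)` for all of them;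
* `hirzebruch_firstChernClass_sq_eq_almostComplex_four_of_signatureTheorem_of_chernSignBit`,
  **`even_one_add_bOne_add_bPlus_of_symplectic_four_of_signatureTheorem_of_chernSignBit_of_wuClass`**,
  `even_one_add_bOne_add_bPlus_of_symplectic_four_of_signatureTheorem_of_example_of_wuClass` — the
  named facts `hirzebruch_firstChernClass_sq_eq_almostComplex_four` and
  `even_one_add_bOne_add_bPlus_of_symplectic_four` follow from the signature theorem, (V)
  `c₁ ≡ v₂ (mod 2)`, and the bit / one example.

Everything is proved; no named facts.

## References

* [McDuffSalamon2017] D. McDuff, D. Salamon, Introduction to Symplectic Topology, 3rd ed., OUP 2017,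
  Ex. 4.4.3 (v), Rem. 4.1.10, Rem. 4.1.12, §13.3.
* [Hirzebruch1966] F. Hirzebruch, Topological Methods in Algebraic Geometry, 3rd ed., 1966, Thm. 4.10.1.
* [Bredon1993] G. E. Bredon, Topology and Geometry, GTM 139, 1993, VI.7, Thm. V.9.5.
-/

noncomputable section

open scoped Manifold ContDiff Topology
open Set Function Module
open Literature.AlgebraicTopology.SingularHomology Literature.AlgebraicTopology.CharacteristicClasses
open Literature.Topology.FourManifolds Literature.Topology.FourManifolds.HomologicalOrientationOfSmooth
open Literature.Geometry.Kaehler Literature.Geometry.Manifold Literature.Geometry.Manifold.DeRhamSignFour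

namespace Literature.Geometry.Symplectic

/-! ### The bit -/

section Bit

/-- **The Chern sign bit** `ε u ∈ {±1}`: the product of the universal de Rham sign `ε = deRhamSignFour`
and the universal top-Chern sign `u = topChernSignFour` (both compensate the `Classical.choice` of the
reference generator `μE 4`; their product does not depend on it). [folklore] -/
def chernSignBit : ℤ := deRhamSignFour * topChernSignFour

/-- `ε u = ±1`. [folklore] -/
theorem chernSignBit_eq_one_or_eq_neg_one : chernSignBit = 1 ∨ chernSignBit = -1 := by
  unfold chernSignBit
  rcases deRhamSignFour_eq_one_or_eq_neg_one with h | h <;>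
    rcases topChernSignFour_eq_one_or_eq_neg_one with h' | h' <;> rw [h, h'] <;> norm_num

/-- `(ε u)² = 1`. [folklore] -/
theorem chernSignBit_mul_self : chernSignBit * chernSignBit = 1 := by
  rcases chernSignBit_eq_one_or_eq_neg_one with h | h <;> rw [h] <;> norm_num

end Bit

/-! ### The complex orientation against the atlas orientation -/

section Main

variable {N : Type} [TopologicalSpace N] [T2Space N] [CompactSpace N] [ConnectedSpace N]
  [ChartedSpace (EuclideanSpace ℝ (Fin 4)) N] [IsManifold (𝓡 4) ∞ N] (J : AlmostComplexStructure (𝓡 4) ∞ N)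

/-- **`μ_J = ε μ_o`**: a homological orientation induced by `J` is the atlas orientation `μ_o` of
any `J`-positive form if `ε = deRhamSignFour = 1`, and `-μ_o` if `ε = -1` (`μ_J = ±μ_o` on a
connected closed manifold; `J`-positive forms pair positively with `[N]_{μ_J}` by definition, and with
sign `ε` with `[N]_{μ_o}`). [cite: McDuffSalamon2017, Rem. 4.1.12] [cite: Bredon1993, VI.7 Thm. 7.15 and Thm. V.9.5] -/
theorem _root_.Literature.AlgebraicTopology.SingularHomology.HomologicalOrientation.IsComplexOrientationOf.eq_or_eq_neg_of_deRhamSignFour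
    {μ : HomologicalOrientation ℤ N 4} (hμ : μ.IsComplexOrientationOf J) {v : MForm (𝓡 4) N ℝ 4}
    (hv : IsSmoothForm v) (hJv : J.IsPositiveTopForm v) :
    (deRhamSignFour = 1 ∧ μ = homologicalOrientationOfSmooth (J.smoothOrientationOfPositiveTopForm v hv hJv)) ∨
      (deRhamSignFour = -1 ∧ μ = -homologicalOrientationOfSmooth (J.smoothOrientationOfPositiveTopForm v hv hJv)) := by
  set μ₀ := homologicalOrientationOfSmooth (J.smoothOrientationOfPositiveTopForm v hv hJv) with hμ₀
  -- the universal sign on the atlas orientation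
  have hε : 0 < (deRhamSignFour : ℝ) * periodFunctional v hv (isClosedForm_four v) μ₀.fundamentalClass :=
    deRhamSignFour_mul_rayPeriod_pos N v hv hJv.apply_ne_zero
  have hpos := hμ.periodFunctional_fundamentalClass_pos hv (isClosedForm_four v) hJv
  have hcases := HomologicalOrientation.eq_or_eq_neg_of_connected_holds N μ μ₀
  rcases deRhamSignFour_eq_one_or_eq_neg_one with h | h <;> rw [h] at hε ⊢
  · refine Or.inl ⟨rfl, ?_⟩
    rcases hcases with h1 | h1
    · exact h1
    · exfalso
      rw [h1, AlmostComplexStructure.periodFunctional_fundamentalClass_neg] at hpos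
      rw [Int.cast_one, one_mul] at hε
      linarith
  · refine Or.inr ⟨rfl, ?_⟩
    rcases hcases with h1 | h1
    · exfalso
      rw [h1] at hpos
      rw [Int.cast_neg, Int.cast_one, neg_one_mul] at hε
      linarith
    · exact h1

/-- **`⟨c₂(TN, J), [N]_μ⟩ = ε u · χ(N)`** for every closed connected almost complex `4`-manifold and
every homological orientation `μ` induced by `J`: the top Chern number on the COMPLEX orientation is
the Euler characteristic up to the single universal bit `chernSignBit = ε u ∈ {±1}` (McDuff–Salamon
assert `+χ(N)`). [cite: McDuffSalamon2017, Ex. 4.4.3 (v)] [cite: Hirzebruch1966, Thm. 4.10.1] -/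
theorem kroneckerPairing_chernClass_two_of_isComplexOrientationOf (μ : HomologicalOrientation ℤ N 4)
    (hμ : μ.IsComplexOrientationOf J) :
    kroneckerPairing ℤ ℤ N 4 (degCast ℤ (by norm_num : 2 * 2 = 4) (J.chernClass 2)) μ.fundamentalClass =
      chernSignBit * relEuler ℤ ℤ N ∅ := by
  obtain ⟨v, hv, hJv⟩ := J.exists_isPositiveTopForm
  have hmain := kroneckerPairing_chernClass_two_homologicalOrientationOfSmooth J hv hJv
  rcases hμ.eq_or_eq_neg_of_deRhamSignFour J hv hJv with ⟨h, rfl⟩ | ⟨h, rfl⟩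
  · rw [hmain, chernSignBit, h, one_mul]
  · rw [HomologicalOrientation.fundamentalClass_neg_holds (R := ℤ) (X := N) 4, map_neg, hmain, chernSignBit, h, neg_one_mul, neg_mul]

/-- `0 ≤ ⟨c₂(TN, J), [N]_μ⟩ · χ(N)` **iff** `χ(N) = 0` or the bit is `+1`. [cite: McDuffSalamon2017, Ex. 4.4.3 (v)] -/
theorem kroneckerPairing_chernClass_two_mul_relEuler_nonneg_iff (μ : HomologicalOrientation ℤ N 4)
    (hμ : μ.IsComplexOrientationOf J) :
    0 ≤ kroneckerPairing ℤ ℤ N 4 (degCast ℤ (by norm_num : 2 * 2 = 4) (J.chernClass 2)) μ.fundamentalClass * relEuler ℤ ℤ N ∅ ↔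
      relEuler ℤ ℤ N ∅ = 0 ∨ chernSignBit = 1 := by
  rw [kroneckerPairing_chernClass_two_of_isComplexOrientationOf J μ hμ]
  rcases chernSignBit_eq_one_or_eq_neg_one with h | h <;> rw [h]
  · simp only [one_mul, or_true, iff_true]
    exact mul_self_nonneg _
  · constructor
    · intro h0
      left
      nlinarith [mul_self_nonneg (relEuler ℤ ℤ N ∅)]
    · rintro (h0 | h0)
      · rw [h0, mul_zero]
      · norm_num at h0

/-- **The bit gives the top Chern number theorem**: if `ε u = 1` then `⟨c₂(TN, J), [N]_μ⟩ = χ(N)` for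
every closed connected almost complex `4`-manifold. [cite: McDuffSalamon2017, Ex. 4.4.3 (v)] -/
theorem kroneckerPairing_chernClass_two_eq_relEuler_of_chernSignBit (hbit : chernSignBit = 1)
    (μ : HomologicalOrientation ℤ N 4) (hμ : μ.IsComplexOrientationOf J) :
    kroneckerPairing ℤ ℤ N 4 (degCast ℤ (by norm_num : 2 * 2 = 4) (J.chernClass 2)) μ.fundamentalClass = relEuler ℤ ℤ N ∅ := by
  rw [kroneckerPairing_chernClass_two_of_isComplexOrientationOf J μ hμ, hbit, one_mul]

/-- **One example pins the bit**: if some closed connected almost complex `4`-manifold with `χ ≠ 0`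
has `⟨c₂(TN, J), [N]_μ⟩ = χ(N)` for an orientation induced by `J`, then `ε u = 1`.
[cite: McDuffSalamon2017, Ex. 4.4.3 (v)] -/
theorem chernSignBit_eq_one_of_example (μ : HomologicalOrientation ℤ N 4) (hμ : μ.IsComplexOrientationOf J)
    (hχ : relEuler ℤ ℤ N ∅ ≠ 0)
    (h : kroneckerPairing ℤ ℤ N 4 (degCast ℤ (by norm_num : 2 * 2 = 4) (J.chernClass 2)) μ.fundamentalClass = relEuler ℤ ℤ N ∅) :
    chernSignBit = 1 := by
  rw [kroneckerPairing_chernClass_two_of_isComplexOrientationOf J μ hμ] at h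
  rcases chernSignBit_eq_one_or_eq_neg_one with h1 | h1
  · exact h1
  · exfalso
    rw [h1, neg_one_mul] at h
    exact hχ (by linarith)

end Main

/-! ### Reductions of the named facts to the bit / to one example -/

section Reductions

/-- **(H) `⟨c₁², [N]⟩ = 2χ + 3σ` from the signature theorem and the bit.**
[cite: McDuffSalamon2017, Rem. 4.1.10 (pp. 161–162)] [cite: Hirzebruch1966, Thm. 4.10.1 and Thm. 8.2.2] -/
theorem hirzebruch_firstChernClass_sq_eq_almostComplex_four_of_signatureTheorem_of_chernSignBit
    (hsig : ∀ (N : Type) [TopologicalSpace N] [T2Space N] [SecondCountableTopology N]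
      [CompactSpace N] [ConnectedSpace N] [ChartedSpace (EuclideanSpace ℝ (Fin 4)) N]
      [IsManifold (𝓡 4) ∞ N] (μ : HomologicalOrientation ℤ N 4),
      kroneckerPairing ℤ ℤ N 4 (degCast ℤ (by norm_num : 4 * 1 = 4) (tangentPontryaginClass (𝓡 4) N 1))
        μ.fundamentalClass = 3 * μ.signature)
    (hbit : chernSignBit = 1) :
    hirzebruch_firstChernClass_sq_eq_almostComplex_four :=
  hirzebruch_firstChernClass_sq_eq_almostComplex_four_of_signatureTheorem_of_sign hsig
    fun _ _ _ _ _ _ _ _ J μ hμ ↦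
      (kroneckerPairing_chernClass_two_mul_relEuler_nonneg_iff J μ hμ).2 (Or.inr hbit)

/-- **`even_one_add_bOne_add_bPlus_of_symplectic_four` from the signature theorem, the bit, and (V)
`c₁ ≡ v₂ (mod 2)`.** [cite: McDuffSalamon2017, §13.3 p. 527, Rem. 13.3.5 and Rem. 4.1.10] -/
theorem even_one_add_bOne_add_bPlus_of_symplectic_four_of_signatureTheorem_of_chernSignBit_of_wuClass
    (hsig : ∀ (N : Type) [TopologicalSpace N] [T2Space N] [SecondCountableTopology N]
      [CompactSpace N] [ConnectedSpace N] [ChartedSpace (EuclideanSpace ℝ (Fin 4)) N]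
      [IsManifold (𝓡 4) ∞ N] (μ : HomologicalOrientation ℤ N 4),
      kroneckerPairing ℤ ℤ N 4 (degCast ℤ (by norm_num : 4 * 1 = 4) (tangentPontryaginClass (𝓡 4) N 1))
        μ.fundamentalClass = 3 * μ.signature)
    (hbit : chernSignBit = 1) (hV : firstChernClass_modTwo_eq_wuClass_almostComplex_four) :
    even_one_add_bOne_add_bPlus_of_symplectic_four :=
  even_one_add_bOne_add_bPlus_of_symplectic_four_of_hirzebruch_of_wuClass
    (hirzebruch_firstChernClass_sq_eq_almostComplex_four_of_signatureTheorem_of_chernSignBit hsig hbit) hV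

/-- **`even_one_add_bOne_add_bPlus_of_symplectic_four` from the signature theorem, (V), and ONE
closed connected almost complex `4`-manifold with `χ ≠ 0` and `⟨c₂, [N]_μ⟩ = χ`** (e.g. `ℂℙ²` or
`S² × S²`, McDuff–Salamon Ex. 4.4.3 (v)). [cite: McDuffSalamon2017, §13.3 p. 527, Rem. 4.1.10 and Ex. 4.4.3 (v)] -/
theorem even_one_add_bOne_add_bPlus_of_symplectic_four_of_signatureTheorem_of_example_of_wuClass
    (hsig : ∀ (N : Type) [TopologicalSpace N] [T2Space N] [SecondCountableTopology N]
      [CompactSpace N] [ConnectedSpace N] [ChartedSpace (EuclideanSpace ℝ (Fin 4)) N]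
      [IsManifold (𝓡 4) ∞ N] (μ : HomologicalOrientation ℤ N 4),
      kroneckerPairing ℤ ℤ N 4 (degCast ℤ (by norm_num : 4 * 1 = 4) (tangentPontryaginClass (𝓡 4) N 1))
        μ.fundamentalClass = 3 * μ.signature)
    {N₀ : Type} [TopologicalSpace N₀] [T2Space N₀] [CompactSpace N₀] [ConnectedSpace N₀]
    [ChartedSpace (EuclideanSpace ℝ (Fin 4)) N₀] [IsManifold (𝓡 4) ∞ N₀] (J₀ : AlmostComplexStructure (𝓡 4) ∞ N₀)
    (μ₀ : HomologicalOrientation ℤ N₀ 4) (hμ₀ : μ₀.IsComplexOrientationOf J₀) (hχ₀ : relEuler ℤ ℤ N₀ ∅ ≠ 0)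
    (h₀ : kroneckerPairing ℤ ℤ N₀ 4 (degCast ℤ (by norm_num : 2 * 2 = 4) (J₀.chernClass 2)) μ₀.fundamentalClass = relEuler ℤ ℤ N₀ ∅)
    (hV : firstChernClass_modTwo_eq_wuClass_almostComplex_four) :
    even_one_add_bOne_add_bPlus_of_symplectic_four :=
  even_one_add_bOne_add_bPlus_of_symplectic_four_of_signatureTheorem_of_chernSignBit_of_wuClass hsig
    (chernSignBit_eq_one_of_example J₀ μ₀ hμ₀ hχ₀ h₀) hV

end Reductions

end Literature.Geometry.Symplectic

end
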